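import Summits.Ventures.CertifiedManyBodySolver.Transport.D4VecAction
import Summits.Ventures.CertifiedManyBodySolver.Rows.DopedTLCorr
import Literature.MathematicalPhysics.QuantumLattice.HubbardKineticEnergyDensity
import HarnessLib

/-!
# Ventures/CertifiedManyBodySolver — Observables/KineticWordD4.lean

HONEST FRAMING: first certified bounds on pairing observables; not a superconductivity verdict; every number certified or
labelled float. (hubbard-obs cell, obs-lit seat g2; theorem-only support for the rung-0b `kinlo` edge of hubbard-lower l2-eng-2's EXT5-L⁺ menu
— lead RULING (z1)/(aa2); zero compute, no certificate, no named fact, no `sorry`.)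

**The `D₄`-ORBIT reading of the KINETIC WORD.** The `kinlo` objective of the point-group/SU(2)/conjugation-reduced word programs is the
lattice operator `k̂ = −2 Σ_{δ ∈ {e₁,e₂}} Σ_σ c†_{0σ} c_{δσ}` ("k = −t Σ_{δ,σ}⟨c⁺_{0σ}c_{δσ} + h.c.⟩ (t = 1; 4 words × −2)", mbsolver
`runs/step0obs-eng2-0825` README §5 / `patches_EXT5Lp/patch_kin.json`), read in the G-averaged state; a certificate on such a program is an ORBIT row
`M3CorrOrbitLowerRow tp u q Finset.univ kinWindow kinWord` (`Rows/DopedTLCorr.lean`). This file proves, for EVERY TRANSLATION-INVARIANT `ω` (every torus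
limit), that the `D₄`-orbit mean of `Re ω(Γ_γ k̂)` IS the kinetic energy density in the bond form used by the cell's kinetic rows and by the T6 hook
(`Observables/KineticCeilingStiffnessTL.lean`):
`|D₄|⁻¹ Σ_γ Re ω_{γW}(Γ(d4Emb γ 0 W) k̂) = k(ω) := Σ_i (−1)·Σ_σ (Re ω(c†_{0σ}c_{e_iσ}) + Re ω(c†_{e_iσ}c_{0σ}))` (`re_orbitMean_kinWord_eq_kineticDensity`).
Steps: (1) transport of one hopping word, `Re ω_{γW}(Γ_γ(c†_0 c_{e_i})) = Re ω_{{0,γe_i}}(c†_0 c_{γe_i})` (`Γ(d4Emb) c_{xσ} = c_{γx,σ}`, isotony);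
(2) translation invariance + Hermiticity flip a bond: `Re ω(c†_0 c_{−v}) = Re ω(c†_0 c_v)` (`re_expect_hop_neg`); (3) the orbit of `e₁` runs through
`±e₁, ±e₂` twice (`d4_sum_e1/e2`, Transport/D4VecAction.lean); (4) `Re ω(c†_{e}c_0) = Re ω(c†_0 c_e)` (states are Hermitian). CONSEQUENCE
(`m3CorrOrbitLowerRow_kinWord_negKinetic_le`): an orbit LOWER row `q ≤ k̄` on `kinWord` at the M3′ point yields, for every torus limit of unit
`(rectN (7/8) L, S^z = 0)`-sector ground states of `hubbardTorusTT' L 1 tp 8` within the window, `−k(ω) ≤ −q` — EXACTLY the hypothesis shape of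
`m3_tp0_fluxStiffness_le_quarter_of_forall_negKinetic_le` (T6; `tp = 0`) ⇒ a certified `kinlo` edge `q` becomes the stiffness ceiling `ρ_s ≤ −q/4` by
composing the two (three lines, in the claim-node file of that edge; not done here so that this file depends on no module landed today).
References: Scalapino–White–Zhang, PRB 47 (1993) 7995, §II (f-sum reading) [ScalapinoWhiteZhang1993]; Bratteli–Robinson II §6.2.4 (mean energy per
site of a translation-invariant state) [BratteliRobinsonII1997].
-/

noncomputable section

namespace Summit.Ventures.CertifiedManyBodySolver.Observables

open Literature.MathematicalPhysics.QuantumLattice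
open Literature.MathematicalPhysics.QuantumLattice.ThermodynamicLimit
open Literature.Probability.LatticeModels
open Summit.Ventures.CertifiedManyBodySolver.Transport
open Matrix Finset Filter Topology HubbardWave0
open scoped Matrix BigOperators ComplexOrder

/-! ## §0 The kinetic window and the kinetic word -/

/-- The kinetic window `W = {0, e₁, e₂}` (the support of the `kinlo` objective). [cite: ScalapinoWhiteZhang1993, §II] -/
abbrev kinWindow : Finset (Site 2) := {0, unitVec 0, unitVec 1}

/-- `0 ∈ W`. [folklore] -/
theorem zero_mem_kinWindow : (0 : Site 2) ∈ kinWindow := mem_insert_self _ _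

/-- `e_i ∈ W`. [folklore] -/
theorem unitVec_mem_kinWindow (i : Fin 2) : (unitVec i : Site 2) ∈ kinWindow := by
  fin_cases i
  · exact mem_insert_of_mem (mem_insert_self _ _)
  · exact mem_insert_of_mem (mem_insert_of_mem (mem_singleton_self _))

/-- One hopping word `c†_{0σ} c_{e_iσ} ∈ 𝔄_W`. [cite: ScalapinoWhiteZhang1993, §II] -/
abbrev kinHopWord (i σ : Fin 2) : FermionOp kinWindow :=
  (cAt 0 zero_mem_kinWindow σ)ᴴ * cAt (unitVec i) (unitVec_mem_kinWindow i) σ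

/-- **The kinetic word** `k̂ = −2 Σ_{i,σ} c†_{0σ} c_{e_iσ}` (the `kinlo` objective "4 words × −2", `t = 1`). [cite: ScalapinoWhiteZhang1993, §II] -/
abbrev kinWord : FermionOp kinWindow :=
  (-2 : ℂ) • ∑ i : Fin 2, ∑ σ : Fin 2, kinHopWord i σ

/-! ## §1 One hopping word under `D₄` transport and under a bond flip -/

/-- The real part of a bond hopping expectation, `b_σ(v) := Re ω_{{0,v}}(c†_{0σ} c_{vσ})` (notation-free: used through this expression). -/
theorem re_expect_d4Emb_hopWord (ω : InfVolFermionState 2) (γ : DihedralGroup 4) (i σ : Fin 2) :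
    (ω.expect (d4ShiftSet γ 0 kinWindow) (fermionEmbed (PolySite.d4Emb γ 0 kinWindow) (kinHopWord i σ))).re =
      (ω.expect ({0, d4Vec γ (unitVec i)} : Finset (Site 2))
        ((cAt 0 (mem_insert_self _ _) σ)ᴴ * cAt (d4Vec γ (unitVec i)) (mem_insert_of_mem (mem_singleton_self _)) σ)).re := by
  have h0 : d4Vec γ (0 : Site 2) + 0 = 0 := by rw [add_zero, (d4Vec_eq_zero_iff γ 0).2 rfl]
  have hv : d4Vec γ (unitVec i) + 0 = d4Vec γ (unitVec i) := add_zero _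
  have hsub : ({0, d4Vec γ (unitVec i)} : Finset (Site 2)) ⊆ d4ShiftSet γ 0 kinWindow := by
    intro z hz
    rcases mem_insert.1 hz with rfl | hz
    · have h := d4Vec_add_mem_d4ShiftSet γ 0 zero_mem_kinWindow
      rwa [h0] at h
    · rw [mem_singleton.1 hz]
      have h := d4Vec_add_mem_d4ShiftSet γ 0 (unitVec_mem_kinWindow i)
      rwa [hv] at h
  have h1 : fermionEmbed (PolySite.d4Emb γ 0 kinWindow) (cAt 0 zero_mem_kinWindow σ) = cAt 0 (hsub (mem_insert_self _ _)) σ :=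
    (fermionEmbed_annihilation _ _ _).trans (cAt_congr (d4Vec_add_mem_d4ShiftSet γ 0 zero_mem_kinWindow) _ h0 σ)
  have h2 : fermionEmbed (PolySite.d4Emb γ 0 kinWindow) (cAt (unitVec i) (unitVec_mem_kinWindow i) σ) =
      cAt (d4Vec γ (unitVec i)) (hsub (mem_insert_of_mem (mem_singleton_self _))) σ :=
    (fermionEmbed_annihilation _ _ _).trans (cAt_congr (d4Vec_add_mem_d4ShiftSet γ 0 (unitVec_mem_kinWindow i)) _ hv σ)
  have hw : fermionEmbed (PolySite.d4Emb γ 0 kinWindow) (kinHopWord i σ) =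
      fermionEmbed (PolySite.incl hsub)
        ((cAt 0 (mem_insert_self _ _) σ)ᴴ * cAt (d4Vec γ (unitVec i)) (mem_insert_of_mem (mem_singleton_self _)) σ) := by
    rw [map_mul, map_mul, fermionEmbed_conjTranspose, fermionEmbed_conjTranspose, fermionEmbed_incl_cAt, fermionEmbed_incl_cAt, h1, h2]
  rw [hw, ω.compatible hsub]

/-- **States are Hermitian on a bond**: `Re ω(c†_{vσ} c_{0σ}) = Re ω(c†_{0σ} c_{vσ})`. [cite: BratteliRobinsonII1997, §6.2.4] -/
theorem re_expect_hop_swap (ω : InfVolFermionState 2) (v : Site 2) (σ : Fin 2) :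
    (ω.expect ({0, v} : Finset (Site 2))
        ((cAt v (mem_insert_of_mem (mem_singleton_self _)) σ)ᴴ * cAt 0 (mem_insert_self _ _) σ)).re =
      (ω.expect ({0, v} : Finset (Site 2))
        ((cAt 0 (mem_insert_self _ _) σ)ᴴ * cAt v (mem_insert_of_mem (mem_singleton_self _)) σ)).re := by
  have h : (cAt v (mem_insert_of_mem (mem_singleton_self _)) σ)ᴴ * cAt 0 (mem_insert_self _ _) σ =
      ((cAt 0 (mem_insert_self (0 : Site 2) ({v} : Finset (Site 2))) σ)ᴴ *
        cAt v (mem_insert_of_mem (mem_singleton_self _)) σ)ᴴ := by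
    rw [conjTranspose_mul, conjTranspose_conjTranspose]
  rw [h, ω.expect_conjTranspose, Complex.star_def, Complex.conj_re]

/-- **Translation invariance flips a bond** (real parts): `Re ω(c†_{0σ} c_{−v,σ}) = Re ω(c†_{0σ} c_{vσ})` for translation-invariant `ω`
(shift by `v`, then Hermiticity). [cite: BratteliRobinsonII1997, §6.2.4] -/
theorem re_expect_hop_neg {ω : InfVolFermionState 2} (hω : ω.IsTranslationInvariant) (v : Site 2) (σ : Fin 2) :
    (ω.expect ({0, -v} : Finset (Site 2))
        ((cAt 0 (mem_insert_self _ _) σ)ᴴ * cAt (-v) (mem_insert_of_mem (mem_singleton_self _)) σ)).re =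
      (ω.expect ({0, v} : Finset (Site 2))
        ((cAt 0 (mem_insert_self _ _) σ)ᴴ * cAt v (mem_insert_of_mem (mem_singleton_self _)) σ)).re := by
  -- shift the left-hand side by `v`: `(ω.shift v) = ω`
  have hs : ((ω.shift v).expect ({0, -v} : Finset (Site 2))
      ((cAt 0 (mem_insert_self _ _) σ)ᴴ * cAt (-v) (mem_insert_of_mem (mem_singleton_self _)) σ)).re =
      (ω.expect ({0, -v} : Finset (Site 2))
      ((cAt 0 (mem_insert_self _ _) σ)ᴴ * cAt (-v) (mem_insert_of_mem (mem_singleton_self _)) σ)).re := by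
    rw [hω v]
  rw [← hs, InfVolFermionState.shift_expect, map_mul, fermionEmbed_conjTranspose, fermionEmbed_shiftEmb_cAt,
    fermionEmbed_shiftEmb_cAt]
  -- now the word lives on `shiftSet v {0, -v}` with sites `0 + v = v` and `-v + v = 0`; move it to `{0, v}` by isotony
  have hsub : shiftSet v ({0, -v} : Finset (Site 2)) ⊆ ({0, v} : Finset (Site 2)) := by
    intro z hz
    obtain ⟨y, hy, rfl⟩ := Finset.mem_map.1 hz
    rcases mem_insert.1 hy with rfl | hy
    · exact mem_insert_of_mem (mem_singleton.2 (zero_add v))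
    · rw [mem_singleton.1 hy]
      exact mem_insert.2 (Or.inl (neg_add_cancel v))
  rw [← ω.compatible hsub, map_mul, fermionEmbed_conjTranspose, fermionEmbed_incl_cAt, fermionEmbed_incl_cAt,
    cAt_congr _ (mem_insert_of_mem (mem_singleton_self v)) (zero_add v) σ,
    cAt_congr _ (mem_insert_self (0 : Site 2) {v}) (neg_add_cancel v) σ]
  exact re_expect_hop_swap ω v σ

/-! ## §2 The orbit mean of the kinetic word is the kinetic energy density -/

/-- **Orbit sum of one hopping word** (translation-invariant `ω`): `Σ_γ Re ω_{γW}(Γ_γ (c†_{0σ}c_{e_iσ})) = 4·(Re ω(c†_{0σ}c_{e₁σ}) + Re ω(c†_{0σ}c_{e₂σ}))`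
(the orbit of `e_i` is `{±e₁, ±e₂}`, each twice; the `−e` bonds are flipped by translation invariance). [cite: ScalapinoWhiteZhang1993, §II] -/
theorem sum_re_expect_d4Emb_hopWord {ω : InfVolFermionState 2} (hω : ω.IsTranslationInvariant) (i σ : Fin 2) :
    ∑ γ : DihedralGroup 4, (ω.expect (d4ShiftSet γ 0 kinWindow) (fermionEmbed (PolySite.d4Emb γ 0 kinWindow) (kinHopWord i σ))).re =
      4 * ((ω.expect ({0, 0 + unitVec 0} : Finset (Site 2))
              ((cAt 0 (mem_insert_self _ _) σ)ᴴ * cAt (0 + unitVec 0) (mem_insert_of_mem (mem_singleton_self _)) σ)).re +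
           (ω.expect ({0, 0 + unitVec 1} : Finset (Site 2))
              ((cAt 0 (mem_insert_self _ _) σ)ᴴ * cAt (0 + unitVec 1) (mem_insert_of_mem (mem_singleton_self _)) σ)).re) := by
  simp_rw [re_expect_d4Emb_hopWord]
  set F : Site 2 → ℝ := fun v => (ω.expect ({0, v} : Finset (Site 2))
      ((cAt 0 (mem_insert_self _ _) σ)ᴴ * cAt v (mem_insert_of_mem (mem_singleton_self _)) σ)).re with hF
  have hsum : ∑ γ : DihedralGroup 4, F (d4Vec γ (unitVec i)) = 2 * (F ![1, 0] + F ![-1, 0] + F ![0, 1] + F ![0, -1]) := by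
    have hi : i = 0 ∨ i = 1 := by fin_cases i <;> simp
    rcases hi with rfl | rfl
    · rw [unitVec_zero_eq]; exact d4_sum_e1 F
    · rw [unitVec_one_eq]; exact d4_sum_e2 F
  have hn1 : (![-1, 0] : Site 2) = -![1, 0] := by decide
  have hn2 : (![0, -1] : Site 2) = -![0, 1] := by decide
  have hflip1 : F ![-1, 0] = F ![1, 0] := by simp only [hF]; rw [hn1]; exact re_expect_hop_neg hω _ σ
  have hflip2 : F ![0, -1] = F ![0, 1] := by simp only [hF]; rw [hn2]; exact re_expect_hop_neg hω _ σ
  have he1 : (0 : Site 2) + unitVec 0 = ![1, 0] := by decide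
  have he2 : (0 : Site 2) + unitVec 1 = ![0, 1] := by decide
  simp only [hF] at hsum hflip1 hflip2
  rw [hsum, hflip1, hflip2, he1, he2]
  ring

/-- **The `D₄`-orbit mean of the kinetic word is the kinetic energy density** (translation-invariant `ω`; `|D₄| = 8`):
`|D₄|⁻¹ Σ_γ Re ω_{γW}(Γ(d4Emb γ 0 W) k̂) = Σ_i (−1)·Σ_σ (Re ω(c†_{0σ}c_{e_iσ}) + Re ω(c†_{e_iσ}c_{0σ}))` — the bond form of the cell's kinetic rows
(`m3_tp0_kineticDensity_ge_derived`, `m3_tp0_kineticDensity_ge_chord_r354_r426`) and of the T6 hook. [cite: ScalapinoWhiteZhang1993, §II] -/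
theorem re_orbitMean_kinWord_eq_kineticDensity {ω : InfVolFermionState 2} (hω : ω.IsTranslationInvariant) :
    ((Finset.univ : Finset (DihedralGroup 4)).card : ℝ)⁻¹ *
        ∑ γ ∈ (Finset.univ : Finset (DihedralGroup 4)),
          (ω.expect (d4ShiftSet γ 0 kinWindow) (fermionEmbed (PolySite.d4Emb γ 0 kinWindow) kinWord)).re =
      ∑ i : Fin 2, -(1 : ℝ) * ∑ σ : Fin 2,
        ((ω.expect {0, 0 + unitVec i}
            ((cAt 0 (mem_insert_self _ _) σ)ᴴ * cAt (0 + unitVec i) (mem_insert_of_mem (mem_singleton_self _)) σ)).re +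
          (ω.expect {0, 0 + unitVec i}
            ((cAt (0 + unitVec i) (mem_insert_of_mem (mem_singleton_self _)) σ)ᴴ * cAt 0 (mem_insert_self _ _) σ)).re) := by
  have hcard : ((Finset.univ : Finset (DihedralGroup 4)).card : ℝ) = 8 := by
    rw [Finset.card_univ]; exact_mod_cast (by decide : Fintype.card (DihedralGroup 4) = 8)
  -- expand the word: Re ω(Γ(−2 Σ hop)) = −2 Σ_{i,σ} Re ω(Γ hop)
  have hexp : ∀ γ : DihedralGroup 4,
      (ω.expect (d4ShiftSet γ 0 kinWindow) (fermionEmbed (PolySite.d4Emb γ 0 kinWindow) kinWord)).re =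
        -2 * ∑ i : Fin 2, ∑ σ : Fin 2,
          (ω.expect (d4ShiftSet γ 0 kinWindow) (fermionEmbed (PolySite.d4Emb γ 0 kinWindow) (kinHopWord i σ))).re := by
    intro γ
    rw [show (kinWord : FermionOp kinWindow) = (-2 : ℂ) • ∑ i : Fin 2, ∑ σ : Fin 2, kinHopWord i σ from rfl,
      fermionEmbed_smul, map_smul, smul_eq_mul, show (-2 : ℂ) = ((-2 : ℝ) : ℂ) by norm_num, Complex.re_ofReal_mul,
      map_sum, map_sum, Complex.re_sum]
    congr 1
    refine Finset.sum_congr rfl fun i _ => ?_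
    rw [map_sum, map_sum, Complex.re_sum]
  simp_rw [hexp]
  rw [hcard, ← Finset.mul_sum, Finset.sum_comm]
  simp_rw [Finset.sum_comm (s := (Finset.univ : Finset (DihedralGroup 4))) (t := (Finset.univ : Finset (Fin 2))),
    sum_re_expect_d4Emb_hopWord hω]
  -- Hermiticity: the reversed hopping words have the same real part
  simp_rw [re_expect_hop_swap]
  simp only [Fin.sum_univ_two]
  ring

/-! ## §3 Orbit rows on the kinetic word read as kinetic bounds (M3′ point) -/

/-- **An orbit LOWER row on the kinetic word is a kinetic FLOOR, i.e. a ceiling on `−k`**: `M3CorrOrbitLowerRow tp u q univ W k̂` gives, for every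
torus limit `ω` of unit `(rectN (7/8) L, S^z = 0)`-sector ground states of `hubbardTorusTT' L 1 tp 8` with `energyDensityTT' 1 tp 8 (7/8) ≤ u`,
`−k(ω) ≤ −q` (bond form) — the hypothesis shape of the T6 hook `m3_tp0_fluxStiffness_le_quarter_of_forall_negKinetic_le` (at `tp = 0`, once the cap is
discharged). [cite: ScalapinoWhiteZhang1993, §II] -/
theorem m3CorrOrbitLowerRow_kinWord_negKinetic_le {tp : ℝ} {u q : ℚ}
    (h : M3CorrOrbitLowerRow tp u q Finset.univ kinWindow kinWord) :
    ∀ (ω : InfVolFermionState 2) (Ls : ℕ → ℕ) (ψ : ∀ L, Fock (Orb (FermionTorus 2 L))),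
      Tendsto Ls atTop atTop →
      (∀ j, IsGroundStateInSector (hubbardTorusTT' (Ls j) 1 tp 8) (rectN (7/8) (Ls j)) 0 (ψ (Ls j))) →
      (∀ j, star (ψ (Ls j)) ⬝ᵥ ψ (Ls j) = 1) → ω.IsTorusLimitOf ψ Ls →
      energyDensityTT' 1 tp 8 (7/8) ≤ ((u : ℚ) : ℝ) →
      -(∑ i : Fin 2, -(1 : ℝ) * ∑ σ : Fin 2,
          ((ω.expect {0, 0 + unitVec i}
              ((cAt 0 (mem_insert_self _ _) σ)ᴴ * cAt (0 + unitVec i) (mem_insert_of_mem (mem_singleton_self _)) σ)).re +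
            (ω.expect {0, 0 + unitVec i}
              ((cAt (0 + unitVec i) (mem_insert_of_mem (mem_singleton_self _)) σ)ᴴ * cAt 0 (mem_insert_self _ _) σ)).re)) ≤
        -((q : ℚ) : ℝ) := by
  intro ω Ls ψ h1 h2 h3 h4 hu
  have hh := h ω Ls ψ h1 h2 h3 h4 hu
  rw [re_orbitMean_kinWord_eq_kineticDensity h4.isTranslationInvariant] at hh
  linarith

/-- The same with the cap taken as the M3′ energy cell `M3EnergyUpperRow tp u` (fed by any landed cap node, e.g. #354 `m3_tp0_upper_dbt299pair_allk_of`
at `tp = 0`): no energy hypothesis left in the conclusion. -/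
theorem m3CorrOrbitLowerRow_kinWord_negKinetic_le_of_cap {tp : ℝ} {u q : ℚ}
    (h : M3CorrOrbitLowerRow tp u q Finset.univ kinWindow kinWord) (hu : M3EnergyUpperRow tp u) :
    ∀ (ω : InfVolFermionState 2) (Ls : ℕ → ℕ) (ψ : ∀ L, Fock (Orb (FermionTorus 2 L))),
      Tendsto Ls atTop atTop →
      (∀ j, IsGroundStateInSector (hubbardTorusTT' (Ls j) 1 tp 8) (rectN (7/8) (Ls j)) 0 (ψ (Ls j))) →
      (∀ j, star (ψ (Ls j)) ⬝ᵥ ψ (Ls j) = 1) → ω.IsTorusLimitOf ψ Ls →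
      -(∑ i : Fin 2, -(1 : ℝ) * ∑ σ : Fin 2,
          ((ω.expect {0, 0 + unitVec i}
              ((cAt 0 (mem_insert_self _ _) σ)ᴴ * cAt (0 + unitVec i) (mem_insert_of_mem (mem_singleton_self _)) σ)).re +
            (ω.expect {0, 0 + unitVec i}
              ((cAt (0 + unitVec i) (mem_insert_of_mem (mem_singleton_self _)) σ)ᴴ * cAt 0 (mem_insert_self _ _) σ)).re)) ≤
        -((q : ℚ) : ℝ) :=
  fun ω Ls ψ h1 h2 h3 h4 => m3CorrOrbitLowerRow_kinWord_negKinetic_le h ω Ls ψ h1 h2 h3 h4 hu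

end Summit.Ventures.CertifiedManyBodySolver.Observables

end
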